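import Literature.Analysis.FluidPDE.Seregin2020AxisymmetricTypeII
import Literature.Analysis.FluidPDE.AxisymPoloidalPart
import Literature.Analysis.FluidPDE.SereginLocalStokesRegularity
import HarnessLib

/-!
# Chen–Tsai–Zhang 2022: slightly supercritical local regularity criteria for axisymmetric
# suitable weak solutions in terms of the poloidal field `b = uʳ e_r + u³ e₃`

Topic `Literature/Analysis/FluidPDE`; named facts (results in print, `def … : Prop`, D-0014) with
proved glue, typed for the ns-blowup cell's profile-search kill table (KILLSHEET-B §1 rows R2-Ab
and R7: «CTZ 2022 Thm 1.5, (p,q) = (2,∞) … Thm 1.3 quantitative … (not typed)» before this file).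

H. Chen, T.-P. Tsai, T. Zhang, *Remarks on local regularity of axisymmetric solutions to the 3D
Navier–Stokes equations*, Comm. Partial Differential Equations 47 (2022) = arXiv:2201.01766, §1
(references to the arXiv version, pp. 3–5 and §4 p. 11).

**Setting (§1).** `(u, Π)` a suitable weak solution of Navier–Stokes (`ν = 1`, no force) in
`Q(1) = B(0, 1) × (-1, 0)` in the sense of Def. 1.1 (`u ∈ L^∞(-T,0; L²) ∩ L²(-T,0; H¹)`,
`Π ∈ L^{3/2}`, the equations in the sense of distributions, the local energy inequality), axially
symmetric about the `x₃`-axis ((1.4): `u = uʳ(r,x₃,t) e_r + u^θ e_θ + u³ e₃`, `Π = Π(r, x₃, t)`);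
`b = uʳ e_r + u³ e₃` ((1.5)), `Γ = r u^θ`; `Q(z₀, R) = B(x₀, R) × (t₀ - R², t₀)`,
`L^{p,q}(Q(z₀,R)) = L^q(t₀ - R², t₀; L^p(B(x₀,R)))`;
`A(z₀, R) = sup_{t₀-R²<t<t₀} R⁻¹ ∫_{B(x₀,R)} |u(x,t)|² dx` ((1.6)); the weight
`ω(R) = (ln ln (100/R))⁻¹`; for `1 < p, q ≤ ∞`, `3/p + 2/q = 2 - γ`, `0 < γ < 1`:
`G(z₀, R) = R^{1-3/p-2/q} ‖b‖_{L^{p,q}(Q(z₀,R))}`, `G_α(z₀, R) = G(z₀, R) ω(R)^α`,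
`0 < α < α₀ = γ/(48 + 16γ)` ((1.17)).

> **Proposition 1.2.** Assume that `(u, Π)` is an axisymmetric suitable weak solution to the
> Navier–Stokes equations in `Q(1)` and there exist constants `β ∈ (0, 1/8)` and `K > 0` such that
> `A(z₀, R) ω(R)^β ≤ K` for all `0 < R ≤ 1/4` [and] for all `z₀ = (0, x_{0,3}, t₀) ∈ Q(1/8)`. Then
> [for any `0 < τ < 1` there exists `c = c(K, β, τ)` such that] for `0 < r ≤ 1/4`, `|x₃| < 1/8`,
> `-1/64 < t < 0`: `|Γ(r, x₃, t)| ≤ N e^{-c |ln r|^τ}`.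
>
> **Theorem 1.3.** Assume that `(u, Π)` is an axisymmetric suitable weak solution to the
> Navier–Stokes equations in `Q(1)`. If there exists a positive constant `G` such that
> `G_α(z₀, R) ≤ G` for all `z₀ = (0, x_{0,3}, t₀) ∈ Q(1/8)` and `0 < R ≤ 1/4`, then the solution is
> regular at `(0, 0)`.
>
> **Theorem 1.5.** Assume that `(u, Π)` is an axisymmetric suitable weak solution to the
> Navier–Stokes equations in `Q(1)`. The solution is regular at `z₀`, provided that
> `limsup_{R→0} G(z₀, R) < ∞`.

(Thm. 1.5 "covers the regularity criteria (1.9) [Chen–Fang–Zhang] and (1.12) [Seregin 2020]; its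
proof is directly from Lemma 4.1 and regularity criterion (1.12)", i.e. the tree's
`Seregin2020_axisymmetricSingularPoint_typeII`; §4: (1.18) of Thm. 1.3 gives, through Lemma 4.1 and
Prop. 1.2, `|Γ| ≤ N|ln r|⁻²`, whence regularity "by a similar argument in [Lei–Zhang 2017]".)

* `ChenTsaiZhang2022.omega R` — the weight `ω(R) = (ln ln (100/R))⁻¹`;
  `ChenTsaiZhang2022.poloidal u` — the field `b(t) = poloidalPart (u t)`;
  `ChenTsaiZhang2022.poloidalA R z₀ u` — `A_b(z₀, R) = R⁻¹ sup_t ∫_{B(x₀,R)} |b|²`, the accepted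
  `cknA` of `b`, which is `G(z₀, R)²` at `(p, q) = (2, ∞)` (`γ = 1/2`, `α₀ = 1/112`);
  `ChenTsaiZhang2022.poloidalG p q R z₀ u` — `G(z₀, R)` for FINITE exponents over the accepted
  `mixedNorm` (`SereginLocalStokesRegularity.lean`).
* `chenTsaiZhang2022_prop12_swirlModulus` — **Prop. 1.2** (second assertion).
* `chenTsaiZhang2022_thm13_poloidalA` — **Thm. 1.3 at `(p, q) = (2, ∞)`**: a uniform bound
  `A_b(z₀, R) ≤ G² (ln ln (100/R))^{2α}`, `0 < α < 1/112`, at all axis points of `Q(1/8)` makes the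
  origin regular — the row R2-Ab form «`A_b(z₀,R) ≤ K (lnln(100/R))^{1/56-}` ⇒ regular».
* `chenTsaiZhang2022_thm15_poloidalA` — **Thm. 1.5 at `(p, q) = (2, ∞)` at the origin**:
  `limsup_{R→0} A_b(0, R) < ∞` ⇒ the origin is regular.
* `chenTsaiZhang2022_thm15` — **Thm. 1.5 for finite exponents** at the origin.

## Rendering (special cases of the printed statements, never stronger)

Exactly the rendering of the tree's K9 fact `Seregin2020_axisymmetricSingularPoint_typeII`
(`Seregin2020AxisymmetricTypeII.lean`), with Seregin's unit CYLINDER replaced by CTZ's parabolic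
BALL `Q(1)`: Def. 1.1 in `Q(1)` is verbatim the accepted Albritton–Barker class
`IsSuitableWeakSolutionInBall 1 0 u p` (`LocalTypeI.lean`: the accepted local notion
`IsSuitableWeakSolutionOn` on `Q(1) = parabolicCylinder 1 0` — distributional solution, local energy
inequality against `C_c^∞` cut-offs — together with the GLOBAL classes on `Q(1)`,
`esssup_t ∫_{B(0,1)} |u(t)|² < ∞`, `∇u ∈ L²(Q(1))` through a weak spatial gradient,
`Π ∈ L^{3/2}(Q(1))`); space–time points are written time first, `z = (t, x)`, `0 = (0, 0)` the
top centre of `Q(1)`.  Axial symmetry is imposed on every slice `u t`, `Π t`, `-1 < t < 0`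
(`IsAxisymmetric` / `IsAxisymmetricScalar`, axis `x₃ = x 2`), stronger than (1.4) a.e. and hence
harmless as a hypothesis.  `b(t) = poloidalPart (u t) = u t - u^θ e_θ` (`AxisymPoloidalPart.lean`,
Seregin–Zajaczkowski's `V^a = V_ϱ e_ϱ + V₃ e₃`), `Γ = swirl`, `r = cylRadius`; the "axis points
`z₀ = (0, x_{0,3}, t₀) ∈ Q(1/8)`" are the `z₀ ∈ parabolicCylinder (1/8) 0` with `cylRadius z₀.2 = 0`.
`A` is the accepted `cknA` (a genuine `sup` over `t`, as printed in (1.6)); at `(p, q) = (2, ∞)`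
the printed `‖b‖_{L^{2,∞}}` is an `ess sup` in time, so `G(z₀,R)² ≤ A_b(z₀,R) := cknA R z₀ b` and
a hypothesis on `A_b` is STRONGER than the printed one on `G` — the facts below are weaker than
print.  For finite `1 < p, q < ∞` the printed `G` is `poloidalG` over the accepted `mixedNorm`
(Thm. 1.5 only; the cases `p = ∞` or `q = ∞` other than `(2, ∞)`, and Thm. 1.3 for exponents
other than `(2, ∞)`, are not rendered — no consumer; the pattern is the same).  "Regular at `(0, 0)`" /
"regular at `z₀`" (a point on the top of `Q(1)`): `u ∈ L^∞(Q(0, r))` for some `r > 0`, the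
negation of the accepted `IsBackwardSingularPoint u 0`, written out as in
`Seregin2020_axisymmetricSingularPoint_typeII.typeI_regular`; Thm. 1.5 is rendered at the centre
`z₀ = (0, 0)` only (any interior axis point reduces to it by translation and parabolic scaling,
not formalised).  In Prop. 1.2 the constants `c`, `N` are allowed to depend on everything (print:
`c = c(K, β, τ)`, `N` "the general constant"), and the pointwise modulus is asserted for a.e.
`(t, x)` of the printed region (the solution is an a.e.-defined field; print states it for the
smooth representative off the axis) — both weaker than print.  Viscosity `ν = 1`, no force, as
printed.  Not restated: Prop. 1.2's oscillation decay (1.15), Thm. 1.4 (the `Ḃ⁻¹_{∞,∞}` blow-up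
rate for classical solutions, which needs the Littlewood–Paley realisation of `b(t)`), §2–§3.

Proved here: `A_b ≤ A` (`poloidalA_le_cknA`, from `|b| ≤ |u|`), whence **Thm. 1.5 at `(2, ∞)`
contains the `A`-part of Seregin 2020, Thm. 2.1** (`chenTsaiZhang2022_thm15_poloidalA.regular_of_limsup_cknA_lt_top`:
`limsup A(0,R) < ∞ ⇒ limsup A_b(0,R) < ∞ ⇒ regular`), and the positivity of the weight on
`(0, 1/4]` (`ChenTsaiZhang2022.omega_pos`).

## Mathlib / tree search

Mathlib has no Navier–Stokes theory.  `lean search '2201.01766|ChenTsaiZhang|Tsai.*Zhang'`: no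
declaration (2026-08-26; bib key `ChenTsaiZhang2022` present).  Reused: `cknA`, `parabolicCylinder`,
`IsSuitableWeakSolutionOn` (`SuitableWeak.lean`); `IsSuitableWeakSolutionInBall`,
`IsBackwardSingularPoint` (`LocalTypeI.lean`); `poloidalPart`, `norm_poloidalPart_le`
(`AxisymPoloidalPart.lean`); `mixedNorm` (`SereginLocalStokesRegularity.lean`); `IsAxisymmetric`,
`IsAxisymmetricScalar`, `swirl`, `cylRadius` (`AxisymmetricEuler.lean`).  Neighbours:
`Seregin2020_axisymmetricSingularPoint_typeII` (the `α = 0`, full-velocity criterion (1.12)),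
`seregin2022_logSwirl_regularAtOrigin` (Seregin's parallel lnln-criterion engine),
`LeiZhang2017_logModulus_regularity` / `Wei2016_logModulus_regularity` (the global swirl-modulus
criteria the proofs end in), `knss_bound_C_over_r` (the `K·r⁻¹` criterion that Pan / CTZ relax by
the lnln factor).

## References

* H. Chen, T.-P. Tsai, T. Zhang, Comm. PDE 47 (2022), arXiv:2201.01766: Def. 1.1, (1.4)–(1.6),
  Prop. 1.2, (1.17), Thm. 1.3, Thm. 1.5, §4 (Lemma 4.1, proofs). [`ChenTsaiZhang2022`]
* G. Seregin, Anal. Math. Phys. 10 (2020), Paper 46, Thm. 2.1 (criterion (1.12)). [`Seregin2020`]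
* D. Albritton, T. Barker, Arch. Ration. Mech. Anal. 232 (2019), Def. 2.1 (the class in a
  parabolic ball). [`AlbrittonBarker2019`]
-/

noncomputable section

open MeasureTheory Set Function Filter Topology TopologicalSpace Metric
open scoped NNReal ENNReal

namespace Literature.Analysis.FluidPDE

/-- Local notation for physical space `ℝ³ = EuclideanSpace ℝ (Fin 3)`. -/
local notation "ℝ³" => EuclideanSpace ℝ (Fin 3)

namespace ChenTsaiZhang2022

/-! ### The weight, the poloidal field and the quantities `A_b`, `G` -/

/-- The logarithmic weight `ω(R) = (ln ln (100/R))⁻¹` of Chen–Tsai–Zhang 2022 (§1, before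
Prop. 1.2). [cite: ChenTsaiZhang2022, §1 (definition of ω(R) before Prop. 1.2)] -/
def omega (R : ℝ) : ℝ :=
  (Real.log (Real.log (100 / R)))⁻¹

/-- The **poloidal field** `b = uʳ e_r + u³ e₃ = u - u^θ e_θ` of a time-dependent velocity field
(Chen–Tsai–Zhang 2022, (1.5): "where `b = uʳ e_r + u³ e₃`"), slice by slice through the accepted
`poloidalPart`. [cite: ChenTsaiZhang2022, (1.5)] -/
def poloidal (u : ℝ → ℝ³ → ℝ³) : ℝ → ℝ³ → ℝ³ := fun t x => poloidalPart (u t) x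

/-- Unfolding `poloidal`. [cite: ChenTsaiZhang2022, (1.5)] -/
@[simp] theorem poloidal_apply (u : ℝ → ℝ³ → ℝ³) (t : ℝ) (x : ℝ³) :
    poloidal u t x = poloidalPart (u t) x := rfl

/-- **`A_b(z₀, R) = sup_{t₀-R²<t<t₀} R⁻¹ ∫_{B(x₀,R)} |b(x,t)|² dx`**, the scaled energy (1.6) of the
poloidal field `b`: the accepted `cknA` of `poloidal u`.  At `(p, q) = (2, ∞)` (`γ = 1/2`) the
printed `G(z₀, R) = R^{-1/2}‖b‖_{L^{2,∞}(Q(z₀,R))}` satisfies `G(z₀,R)² ≤ A_b(z₀,R)` (the printed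
time norm is an `ess sup`, `cknA` a `sup`). [cite: ChenTsaiZhang2022, (1.6) and (1.17) with (p,q) = (2,∞)] -/
def poloidalA (R : ℝ) (z₀ : ℝ × ℝ³) (u : ℝ → ℝ³ → ℝ³) : ℝ≥0∞ :=
  cknA R z₀ (poloidal u)

/-- **`G(z₀, R) = R^{1-3/p-2/q} ‖b‖_{L^{p,q}(Q(z₀,R))}`** ((1.17)) for FINITE exponents
`1 < p, q < ∞`, over the accepted mixed Lebesgue norm `mixedNorm p q z₀ R` on the backward
parabolic cylinder (`L^{p,q}(Q(z₀,R)) = L^q(t₀-R², t₀; L^p(B(x₀,R)))`).  Intended for `R > 0`.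
[cite: ChenTsaiZhang2022, (1.17)] -/
def poloidalG (p q : ℝ) (R : ℝ) (z₀ : ℝ × ℝ³) (u : ℝ → ℝ³ → ℝ³) : ℝ≥0∞ :=
  ENNReal.ofReal (R ^ (1 - 3 / p - 2 / q)) * mixedNorm p q z₀ R (uncurry (poloidal u))

/-! ### Elementary properties (proved) -/

/-- `|b| ≤ |u|` pointwise. [cite: ChenTsaiZhang2022, (1.5)] -/
theorem norm_poloidal_le (u : ℝ → ℝ³ → ℝ³) (t : ℝ) (x : ℝ³) : ‖poloidal u t x‖ ≤ ‖u t x‖ :=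
  norm_poloidalPart_le (u t) x

/-- **`A_b ≤ A`**: the scaled energy of the poloidal part is dominated by that of the full velocity
(`|b| ≤ |u|`). [cite: ChenTsaiZhang2022, (1.5)–(1.6)] -/
theorem poloidalA_le_cknA (R : ℝ) (z₀ : ℝ × ℝ³) (u : ℝ → ℝ³ → ℝ³) :
    poloidalA R z₀ u ≤ cknA R z₀ u := by
  unfold poloidalA cknA
  refine iSup₂_mono fun t _ => ?_
  refine mul_le_mul_right (lintegral_mono fun x => ?_) _
  have h : ‖poloidal u t x‖ₑ ≤ ‖u t x‖ₑ := by
    rw [← ofReal_norm, ← ofReal_norm]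
    exact ENNReal.ofReal_le_ofReal (norm_poloidal_le u t x)
  exact pow_le_pow_left' h 2

/-- The weight is positive on `(0, 1/4]`: `100/R ≥ 400 > e^e`, so `ln ln (100/R) > 1 > 0`.
[cite: ChenTsaiZhang2022, §1 (ω(R) is used for 0 < R ≤ 1/4)] -/
theorem omega_pos {R : ℝ} (hR : 0 < R) (hR4 : R ≤ 1 / 4) : 0 < omega R := by
  unfold omega
  refine inv_pos.mpr (Real.log_pos ?_)
  -- `1 < log (100 / R)` since `exp 1 < 3 ≤ 400 ≤ 100 / R`
  have h400 : (400 : ℝ) ≤ 100 / R := by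
    rw [le_div_iff₀ hR]
    linarith
  have he : Real.exp 1 < 100 / R :=
    lt_of_lt_of_le (Real.exp_one_lt_d9.trans (by norm_num)) h400
  have hpos : 0 < 100 / R := by positivity
  calc (1 : ℝ) = Real.log (Real.exp 1) := (Real.log_exp 1).symm
    _ < Real.log (100 / R) := Real.log_lt_log (Real.exp_pos 1) he

end ChenTsaiZhang2022

open ChenTsaiZhang2022

/-! ### The named facts -/

/-- **Chen–Tsai–Zhang 2022, Proposition 1.2 (second assertion): a slightly supercritical bound on
the scaled energy at the axis forces a logarithmic modulus of the swirl.**  "Assume that `(u, Π)`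
is an axisymmetric suitable weak solution to the Navier–Stokes equations in `Q(1)` and there exist
constants `β ∈ (0, 1/8)` and `K > 0` such that `A(z₀, R) ω(R)^β ≤ K` for all `0 < R ≤ 1/4`" and
all `z₀ = (0, x_{0,3}, t₀) ∈ Q(1/8)`; "then [for any `0 < τ < 1`] we have that for
`0 < r ≤ 1/4`, `|x₃| < 1/8`, `-1/64 < t < 0`, `|Γ(r, x₃, t)| ≤ N e^{-c |ln r|^τ}`" (`c = c(K, β, τ)`,
`N` the general constant).  Rendered (module docstring) in the Albritton–Barker class on `Q(1)`
with axisymmetric slices, `A = cknA`, `ω = ChenTsaiZhang2022.omega`, `Γ = swirl`, the bound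
asserted a.e. on the printed region with constants `c > 0`, `N` depending on the solution.
[cite: ChenTsaiZhang2022, Prop. 1.2 (arXiv:2201.01766 §1, (1.14) ⇒ (1.16))] -/
def chenTsaiZhang2022_prop12_swirlModulus : Prop :=
  ∀ (u : ℝ → ℝ³ → ℝ³) (p : ℝ → ℝ³ → ℝ),
    IsSuitableWeakSolutionInBall 1 0 u p →
    (∀ t ∈ Ioo (-1 : ℝ) 0, IsAxisymmetric (u t)) →
    (∀ t ∈ Ioo (-1 : ℝ) 0, IsAxisymmetricScalar (p t)) →
    ∀ (β K : ℝ), 0 < β → β < 1 / 8 → 0 < K →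
    (∀ z₀ ∈ parabolicCylinder (1 / 8) (0 : ℝ × ℝ³), cylRadius z₀.2 = 0 →
      ∀ R : ℝ, 0 < R → R ≤ 1 / 4 →
        cknA R z₀ u * ENNReal.ofReal (omega R ^ β) ≤ ENNReal.ofReal K) →
    ∀ τ : ℝ, 0 < τ → τ < 1 → ∃ c : ℝ, 0 < c ∧ ∃ N : ℝ,
      ∀ᵐ z ∂(volume.restrict {z : ℝ × ℝ³ | z.1 ∈ Ioo (-(1 / 64) : ℝ) 0 ∧
          0 < cylRadius z.2 ∧ cylRadius z.2 ≤ 1 / 4 ∧ |z.2 2| < 1 / 8}),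
        |swirl (u z.1) z.2| ≤ N * Real.exp (-(c * |Real.log (cylRadius z.2)| ^ τ))

/-- **Chen–Tsai–Zhang 2022, Theorem 1.3 at `(p, q) = (2, ∞)` (slightly supercritical scaled
poloidal energy at the axis ⇒ regularity).**  "Assume that `(u, Π)` is an axisymmetric suitable
weak solution to the Navier–Stokes equations in `Q(1)`. If there exists a positive constant `G`
such that `G_α(z₀, R) ≤ G` for all `z₀ = (0, x_{0,3}, t₀) ∈ Q(1/8)` and `0 < R ≤ 1/4`, then the
solution is regular at `(0, 0)`", with `G_α = G(z₀,R) ω(R)^α`, `0 < α < α₀ = γ/(48 + 16γ)`; here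
`(p, q) = (2, ∞)`, `γ = 1/2`, `α₀ = 1/112`, `G(z₀,R)² ≤ A_b(z₀,R) = cknA R z₀ b` (module
docstring), so the hypothesis is rendered as `A_b(z₀,R)^{1/2} ω(R)^α ≤ G` (stronger than print)
and the conclusion as `u ∈ L^∞(Q(0, r))` for some `r > 0`.
[cite: ChenTsaiZhang2022, Thm. 1.3 with (1.17) at (p,q) = (2,∞) (arXiv:2201.01766 §1)] -/
def chenTsaiZhang2022_thm13_poloidalA : Prop :=
  ∀ (u : ℝ → ℝ³ → ℝ³) (p : ℝ → ℝ³ → ℝ),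
    IsSuitableWeakSolutionInBall 1 0 u p →
    (∀ t ∈ Ioo (-1 : ℝ) 0, IsAxisymmetric (u t)) →
    (∀ t ∈ Ioo (-1 : ℝ) 0, IsAxisymmetricScalar (p t)) →
    ∀ (α G : ℝ), 0 < α → α < 1 / 112 → 0 < G →
    (∀ z₀ ∈ parabolicCylinder (1 / 8) (0 : ℝ × ℝ³), cylRadius z₀.2 = 0 →
      ∀ R : ℝ, 0 < R → R ≤ 1 / 4 →
        poloidalA R z₀ u ^ (1 / 2 : ℝ) * ENNReal.ofReal (omega R ^ α) ≤ ENNReal.ofReal G) →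
    ∃ r > 0, eLpNorm (uncurry u) ∞ (volume.restrict (parabolicCylinder r (0 : ℝ × ℝ³))) < ∞

/-- **Chen–Tsai–Zhang 2022, Theorem 1.5 at `(p, q) = (2, ∞)`, at the origin (bounded scaled
poloidal energy ⇒ regularity — the poloidal sharpening of Seregin's criterion (1.12)).**
"Assume that `(u, Π)` is an axisymmetric suitable weak solution to the Navier–Stokes equations in
`Q(1)`. The solution is regular at `z₀`, provided that `limsup_{R→0} G(z₀, R) < ∞`"; at
`(p, q) = (2, ∞)` and `z₀ = (0, 0)`, with `G² ≤ A_b` (module docstring): if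
`limsup_{R→0⁺} A_b((0,0), R) < ∞` for `A_b = cknA R 0 b`, `b = uʳ e_r + u³ e₃`, then
`u ∈ L^∞(Q(0, r))` for some `r > 0`.
[cite: ChenTsaiZhang2022, Thm. 1.5 with (1.17) at (p,q) = (2,∞), z₀ = (0,0) (arXiv:2201.01766 §1)] -/
def chenTsaiZhang2022_thm15_poloidalA : Prop :=
  ∀ (u : ℝ → ℝ³ → ℝ³) (p : ℝ → ℝ³ → ℝ),
    IsSuitableWeakSolutionInBall 1 0 u p →
    (∀ t ∈ Ioo (-1 : ℝ) 0, IsAxisymmetric (u t)) →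
    (∀ t ∈ Ioo (-1 : ℝ) 0, IsAxisymmetricScalar (p t)) →
    limsup (fun R => poloidalA R (0 : ℝ × ℝ³) u) (𝓝[>] 0) < ∞ →
    ∃ r > 0, eLpNorm (uncurry u) ∞ (volume.restrict (parabolicCylinder r (0 : ℝ × ℝ³))) < ∞

/-- **Chen–Tsai–Zhang 2022, Theorem 1.5 for finite exponents**, at the origin: for
`1 < p, q < ∞`, `3/p + 2/q = 2 - γ`, `0 < γ < 1`, if `limsup_{R→0⁺} G((0,0), R) < ∞` with
`G = poloidalG p q` (`R^{1-3/p-2/q}‖b‖_{L^{p,q}(Q(0,R))}` over the accepted `mixedNorm`), then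
`u ∈ L^∞(Q(0, r))` for some `r > 0`.  (`p'` = the velocity exponent; `p` is the pressure.)
[cite: ChenTsaiZhang2022, Thm. 1.5 with (1.17), z₀ = (0,0) (arXiv:2201.01766 §1), finite exponents] -/
def chenTsaiZhang2022_thm15 : Prop :=
  ∀ (u : ℝ → ℝ³ → ℝ³) (p : ℝ → ℝ³ → ℝ),
    IsSuitableWeakSolutionInBall 1 0 u p →
    (∀ t ∈ Ioo (-1 : ℝ) 0, IsAxisymmetric (u t)) →
    (∀ t ∈ Ioo (-1 : ℝ) 0, IsAxisymmetricScalar (p t)) →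
    ∀ (p' q γ : ℝ), 1 < p' → 1 < q → 0 < γ → γ < 1 → 3 / p' + 2 / q = 2 - γ →
    limsup (fun R => poloidalG p' q R (0 : ℝ × ℝ³) u) (𝓝[>] 0) < ∞ →
    ∃ r > 0, eLpNorm (uncurry u) ∞ (volume.restrict (parabolicCylinder r (0 : ℝ × ℝ³))) < ∞

/-! ### API -/

namespace chenTsaiZhang2022_thm15_poloidalA

variable {u : ℝ → ℝ³ → ℝ³} {p : ℝ → ℝ³ → ℝ}

/-- Thm. 1.5 at `(2, ∞)` applied: bounded `A_b` at the origin ⇒ the origin is not a backward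
singular point. [cite: ChenTsaiZhang2022, Thm. 1.5] -/
theorem not_isBackwardSingularPoint (h : chenTsaiZhang2022_thm15_poloidalA)
    (hsw : IsSuitableWeakSolutionInBall 1 0 u p)
    (hu_ax : ∀ t ∈ Ioo (-1 : ℝ) 0, IsAxisymmetric (u t))
    (hp_ax : ∀ t ∈ Ioo (-1 : ℝ) 0, IsAxisymmetricScalar (p t))
    (hA : limsup (fun R => poloidalA R (0 : ℝ × ℝ³) u) (𝓝[>] 0) < ∞) :
    ¬ IsBackwardSingularPoint u 0 := by
  obtain ⟨r, hr, hfin⟩ := h u p hsw hu_ax hp_ax hA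
  exact fun hsing => hfin.ne (hsing r hr)

/-- **Thm. 1.5 at `(2, ∞)` contains the `A`-part of Seregin 2020, Thm. 2.1 / (1.12)**: since
`A_b ≤ A` (`poloidalA_le_cknA`), a finite `limsup_{R→0} A(0, R)` already gives a finite
`limsup A_b`, hence regularity of the origin.  ("If `α = 0`, we can deduce the following result,
which covers the regularity criteria (1.9) and (1.12).") [cite: ChenTsaiZhang2022, Thm. 1.5 and the sentence before it] -/
theorem regular_of_limsup_cknA_lt_top (h : chenTsaiZhang2022_thm15_poloidalA)
    (hsw : IsSuitableWeakSolutionInBall 1 0 u p)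
    (hu_ax : ∀ t ∈ Ioo (-1 : ℝ) 0, IsAxisymmetric (u t))
    (hp_ax : ∀ t ∈ Ioo (-1 : ℝ) 0, IsAxisymmetricScalar (p t))
    (hA : limsup (fun R => cknA R (0 : ℝ × ℝ³) u) (𝓝[>] 0) < ∞) :
    ∃ r > 0, eLpNorm (uncurry u) ∞ (volume.restrict (parabolicCylinder r (0 : ℝ × ℝ³))) < ∞ := by
  refine h u p hsw hu_ax hp_ax (lt_of_le_of_lt ?_ hA)
  exact limsup_le_limsup (Eventually.of_forall fun R => poloidalA_le_cknA R 0 u)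

end chenTsaiZhang2022_thm15_poloidalA

namespace chenTsaiZhang2022_thm13_poloidalA

variable {u : ℝ → ℝ³ → ℝ³} {p : ℝ → ℝ³ → ℝ}

/-- Thm. 1.3 at `(2, ∞)` applied, conclusion as "the origin is not a backward singular point".
[cite: ChenTsaiZhang2022, Thm. 1.3] -/
theorem not_isBackwardSingularPoint (h : chenTsaiZhang2022_thm13_poloidalA)
    (hsw : IsSuitableWeakSolutionInBall 1 0 u p)
    (hu_ax : ∀ t ∈ Ioo (-1 : ℝ) 0, IsAxisymmetric (u t))
    (hp_ax : ∀ t ∈ Ioo (-1 : ℝ) 0, IsAxisymmetricScalar (p t))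
    {α G : ℝ} (hα : 0 < α) (hα' : α < 1 / 112) (hG : 0 < G)
    (hb : ∀ z₀ ∈ parabolicCylinder (1 / 8) (0 : ℝ × ℝ³), cylRadius z₀.2 = 0 →
      ∀ R : ℝ, 0 < R → R ≤ 1 / 4 →
        poloidalA R z₀ u ^ (1 / 2 : ℝ) * ENNReal.ofReal (omega R ^ α) ≤ ENNReal.ofReal G) :
    ¬ IsBackwardSingularPoint u 0 := by
  obtain ⟨r, hr, hfin⟩ := h u p hsw hu_ax hp_ax α G hα hα' hG hb
  exact fun hsing => hfin.ne (hsing r hr)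

/-- **A uniform bound on the FULL scaled energy with the lnln gain suffices** (Thm. 1.3 at
`(2, ∞)` composed with `A_b ≤ A`): if `A(z₀,R)^{1/2} ω(R)^α ≤ G` at all axis points of `Q(1/8)`,
`0 < R ≤ 1/4`, `0 < α < 1/112`, the origin is regular. [cite: ChenTsaiZhang2022, Thm. 1.3 with (1.5)–(1.6)] -/
theorem regular_of_cknA_bound (h : chenTsaiZhang2022_thm13_poloidalA)
    (hsw : IsSuitableWeakSolutionInBall 1 0 u p)
    (hu_ax : ∀ t ∈ Ioo (-1 : ℝ) 0, IsAxisymmetric (u t))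
    (hp_ax : ∀ t ∈ Ioo (-1 : ℝ) 0, IsAxisymmetricScalar (p t))
    {α G : ℝ} (hα : 0 < α) (hα' : α < 1 / 112) (hG : 0 < G)
    (hb : ∀ z₀ ∈ parabolicCylinder (1 / 8) (0 : ℝ × ℝ³), cylRadius z₀.2 = 0 →
      ∀ R : ℝ, 0 < R → R ≤ 1 / 4 →
        cknA R z₀ u ^ (1 / 2 : ℝ) * ENNReal.ofReal (omega R ^ α) ≤ ENNReal.ofReal G) :
    ∃ r > 0, eLpNorm (uncurry u) ∞ (volume.restrict (parabolicCylinder r (0 : ℝ × ℝ³))) < ∞ := by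
  refine h u p hsw hu_ax hp_ax α G hα hα' hG fun z₀ hz₀ hax R hR hR4 => ?_
  refine le_trans ?_ (hb z₀ hz₀ hax R hR hR4)
  gcongr
  exact poloidalA_le_cknA R z₀ u

end chenTsaiZhang2022_thm13_poloidalA

end Literature.Analysis.FluidPDE

end
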